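import Mathlib.Analysis.InnerProductSpace.PiL2
import Mathlib.Analysis.Meromorphic.Order
import Mathlib.Analysis.Complex.Basic
import Mathlib.Tactic

/-!
# The sphere at infinity `V∞` meets `H∞` exactly once, transversally
(registered helper `helper_vinfSphereHCount` of line `cross-cap-laurent`, crux
`GromovRecognitionRelEnd`, item stmt-SmoothPoincare4-11009)

In the wedge cap `X` the sphere at infinity `H∞ = {y ∈ U_H | T y = 0} = ηH (ℂ × {0}) ∪ {ηC 0}`
is the zero set of a local complex coordinate `T` (the second complex factor near `H∞`, with
`T (ηC p) = (p 2, p 3)` on the corner bidisc), and `V∞` is the two-chart sphere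
`u z = ηV (0, 0, z)`, `v 0 = ηC 0`, `v w = u w⁻¹` (`w ≠ 0`).  The intersection count of a
two-chart sphere `(u, v)` with `H∞` is the number of zeros of `T ∘ u` in the affine chart, counted
with multiplicity (meromorphic order), plus the order of `T ∘ v` at `w = 0` when the point at
infinity `v 0` lies on `H∞`.

We prove that for `V∞` this count is exactly `1`:
* the affine chart never meets `H∞`: `u z = ηV (0, 0, z)` is a point of the `V`-axis, which is
  disjoint from `ηH (ℂ × {0})` and from the corner point `ηC 0`, so the first sum is empty;
* the point at infinity `v 0 = ηC 0` lies on `H∞` (`T (ηC 0) = 0`), and near `w = 0` the gluing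
  clause `ηC (0, 0, w) = ηV (0, 0, 1/w)` gives `v w = ηC (0, 0, w)`, hence `T (v w) = w`:
  `T ∘ v` agrees with the identity near `0`, whose meromorphic order at `0` is `1`.

Everything is proved from Mathlib (finsum API, `meromorphicOrderAt_congr`, `meromorphicOrderAt_id`);
no definition, no named fact.
-/

-- the registered namespace `Summit.SmoothPoincare4.SmoothPoincare4.Theorems…` repeats a component
set_option linter.dupNamespace false

open Set Filter Topology

namespace Summit.SmoothPoincare4.SmoothPoincare4.Theorems.GromovRecognitionRelEnd.CrossCapLaurent

/-- **`V∞` meets `H∞` exactly once, transversally, at the corner `ηC 0`.**  With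
`H∞ = {y ∈ ηH (D_H) ∪ ηC (D_C) | T y = 0} = ηH (ℂ × {0}) ∪ {ηC 0}`, `T (ηC p) = (p 2, p 3)` on the
corner bidisc, the two-chart sphere `u z = ηV (0, 0, z)`, `v 0 = ηC 0`, `v w = u w⁻¹`, the gluing
clause `ηC p = ηV (p 0, p 1, (p 2, p 3)⁻¹)` off the axis `p 2 = p 3 = 0`, and the disjointness of
the `V`-axis from `ηH (ℂ × {0})` and from `ηC 0`, the intersection count
`∑ᶠ (zeros of T ∘ u on H∞) ord + ∑ᶠ (w = 0 with v 0 ∈ H∞) ord (T ∘ v)` equals `1`: the first sum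
is empty and `T ∘ v = id` near `0`. -/
theorem helper_vinfSphereHCount : ∀ (X : Type) (R₁ : ℝ) (ηH ηV ηC : EuclideanSpace ℝ (Fin 4) → X) (T : X → ℂ) (u v : ℂ → X), 0 < R₁ → (∀ p : EuclideanSpace ℝ (Fin 4), p 0 ^ 2 + p 1 ^ 2 < R₁⁻¹ ^ 2 → p 2 ^ 2 + p 3 ^ 2 < R₁⁻¹ ^ 2 → T (ηC p) = ⟨p 2, p 3⟩) → {y : X | y ∈ (ηH '' {p : EuclideanSpace ℝ (Fin 4) | p 2 ^ 2 + p 3 ^ 2 < R₁⁻¹ ^ 2} ∪ ηC '' {p : EuclideanSpace ℝ (Fin 4) | p 0 ^ 2 + p 1 ^ 2 < R₁⁻¹ ^ 2 ∧ p 2 ^ 2 + p 3 ^ 2 < R₁⁻¹ ^ 2}) ∧ T y = 0} = Set.range (fun z : ℂ => ηH (WithLp.toLp 2 ![z.re, z.im, 0, 0])) ∪ {ηC 0} → (∀ z : ℂ, u z = ηV (WithLp.toLp 2 ![0, 0, z.re, z.im])) → v 0 = ηC 0 → (∀ w : ℂ, w ≠ 0 → v w = u w⁻¹) → (∀ p :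 EuclideanSpace ℝ (Fin 4), p 0 ^ 2 + p 1 ^ 2 < R₁⁻¹ ^ 2 → p 2 ^ 2 + p 3 ^ 2 < R₁⁻¹ ^ 2 → (p 2 ≠ 0 ∨ p 3 ≠ 0) → ηC p = ηV (WithLp.toLp 2 ![p 0, p 1, p 2 / (p 2 ^ 2 + p 3 ^ 2), -(p 3) / (p 2 ^ 2 + p 3 ^ 2)])) → (∀ p q : EuclideanSpace ℝ (Fin 4), p 2 = 0 → p 3 = 0 → q 0 = 0 → q 1 = 0 → ηH p ≠ ηV q) → (∀ q : EuclideanSpace ℝ (Fin 4), q 0 = 0 → q 1 = 0 → ηV q ≠ ηC 0) → (∑ᶠ z ∈ {z : ℂ | u z ∈ (ηH '' {p : EuclideanSpace ℝ (Fin 4) | p 2 ^ 2 + p 3 ^ 2 < R₁⁻¹ ^ 2} ∪ ηC '' {p : EuclideanSpace ℝ (Fin 4) | p 0 ^ 2 + p 1 ^ 2 < R₁⁻¹ ^ 2 ∧ p 2 ^ 2 + p 3 ^ 2 < R₁⁻¹ ^ 2}) ∧ T (u z) = 0}, (meromorphicOrderAt (T ∘ u) z).untop₀) + (∑ᶠ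 w ∈ {w : ℂ | w = 0 ∧ v w ∈ (ηH '' {p : EuclideanSpace ℝ (Fin 4) | p 2 ^ 2 + p 3 ^ 2 < R₁⁻¹ ^ 2} ∪ ηC '' {p : EuclideanSpace ℝ (Fin 4) | p 0 ^ 2 + p 1 ^ 2 < R₁⁻¹ ^ 2 ∧ p 2 ^ 2 + p 3 ^ 2 < R₁⁻¹ ^ 2}) ∧ T (v w) = 0}, (meromorphicOrderAt (T ∘ v) w).untop₀) = 1 := by
  intro X R₁ ηH ηV ηC T u v hR₁ hT hzero hu hv0 hv hglue hdisj hVC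
  have hR : (0 : ℝ) < R₁⁻¹ ^ 2 := pow_pos (inv_pos.mpr hR₁) 2
  -- the open pieces `U_H = ηH (D_H) ∪ ηC (D_C)` around `H∞`
  set U : Set X := ηH '' {p : EuclideanSpace ℝ (Fin 4) | p 2 ^ 2 + p 3 ^ 2 < R₁⁻¹ ^ 2} ∪
    ηC '' {p : EuclideanSpace ℝ (Fin 4) | p 0 ^ 2 + p 1 ^ 2 < R₁⁻¹ ^ 2 ∧
      p 2 ^ 2 + p 3 ^ 2 < R₁⁻¹ ^ 2} with hU
  -- (1) the affine chart `u` of `V∞` never meets `H∞`: the first sum is over the empty set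
  have hS₁ : {z : ℂ | u z ∈ U ∧ T (u z) = 0} = ∅ := by
    refine Set.eq_empty_of_forall_notMem fun z hz => ?_
    have hmem : u z ∈ Set.range (fun z : ℂ => ηH (WithLp.toLp 2 ![z.re, z.im, 0, 0])) ∪ {ηC 0} := by
      rw [← hzero]
      exact hz
    rcases hmem with ⟨a, ha⟩ | h0
    · -- `ηH (a, 0) = u z = ηV (0, 0, z)` contradicts the disjointness of the two axes
      exact hdisj (WithLp.toLp 2 ![a.re, a.im, 0, 0]) (WithLp.toLp 2 ![0, 0, z.re, z.im])
        (by simp) (by simp) (by simp) (by simp) (ha.trans (hu z))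
    · -- `u z = ηC 0` contradicts `ηV (V-axis) ≠ ηC 0`
      exact hVC (WithLp.toLp 2 ![0, 0, z.re, z.im]) (by simp) (by simp)
        ((hu z).symm.trans (Set.mem_singleton_iff.mp h0))
  -- (2) the point at infinity `v 0 = ηC 0` lies on `H∞`: the second sum is over `{0}`
  have hD0 : (0 : EuclideanSpace ℝ (Fin 4)) ∈ {p : EuclideanSpace ℝ (Fin 4) |
      p 0 ^ 2 + p 1 ^ 2 < R₁⁻¹ ^ 2 ∧ p 2 ^ 2 + p 3 ^ 2 < R₁⁻¹ ^ 2} := by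
    refine ⟨?_, ?_⟩ <;> simpa using hR
  have hT0 : T (ηC 0) = 0 := by
    rw [hT 0 hD0.1 hD0.2]
    exact Complex.ext (by simp) (by simp)
  have hS₂ : {w : ℂ | w = 0 ∧ v w ∈ U ∧ T (v w) = 0} = {0} := by
    ext w
    simp only [Set.mem_setOf_eq, Set.mem_singleton_iff]
    constructor
    · exact fun h => h.1
    · rintro rfl
      refine ⟨rfl, ?_, ?_⟩
      · rw [hv0]
        exact Or.inr ⟨0, hD0, rfl⟩
      · rw [hv0]
        exact hT0
  -- (3) near `w = 0`, `T ∘ v` is the identity: `v w = u w⁻¹ = ηV (0, 0, w⁻¹) = ηC (0, 0, w)`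
  have hev : (T ∘ v) =ᶠ[𝓝[≠] (0 : ℂ)] id := by
    have hball : Metric.ball (0 : ℂ) R₁⁻¹ ∈ 𝓝 (0 : ℂ) := Metric.ball_mem_nhds 0 (inv_pos.mpr hR₁)
    filter_upwards [mem_nhdsWithin_of_mem_nhds hball, self_mem_nhdsWithin] with w hw hw0
    have hw0' : w ≠ 0 := hw0
    have hnorm : w.re ^ 2 + w.im ^ 2 < R₁⁻¹ ^ 2 := by
      have h1 : ‖w‖ < R₁⁻¹ := by simpa using hw
      have h2 : ‖w‖ ^ 2 < R₁⁻¹ ^ 2 := pow_lt_pow_left₀ h1 (norm_nonneg _) two_ne_zero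
      rw [Complex.sq_norm, Complex.normSq_apply] at h2
      nlinarith [h2]
    have hsq : Complex.normSq w = w.re ^ 2 + w.im ^ 2 := by
      rw [Complex.normSq_apply]; ring
    set p : EuclideanSpace ℝ (Fin 4) := WithLp.toLp 2 ![0, 0, w.re, w.im] with hp
    have hp0 : p 0 = 0 := by simp [hp]
    have hp1 : p 1 = 0 := by simp [hp]
    have hp2 : p 2 = w.re := by simp [hp]
    have hp3 : p 3 = w.im := by simp [hp]
    have hpC : p 0 ^ 2 + p 1 ^ 2 < R₁⁻¹ ^ 2 := by
      rw [hp0, hp1]; simpa using hR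
    have hpD : p 2 ^ 2 + p 3 ^ 2 < R₁⁻¹ ^ 2 := by
      rw [hp2, hp3]; exact hnorm
    have hp23 : p 2 ≠ 0 ∨ p 3 ≠ 0 := by
      rw [hp2, hp3]
      exact not_and_or.mp fun h => hw0' (Complex.ext (by simpa using h.1) (by simpa using h.2))
    have hvC : v w = ηC p := by
      rw [hv w hw0', hu, hglue p hpC hpD hp23, hp0, hp1, hp2, hp3, Complex.inv_re, Complex.inv_im,
        hsq]
    show T (v w) = w
    rw [hvC, hT p hpC hpD, hp2, hp3, Complex.eta]
  have hord : meromorphicOrderAt (T ∘ v) 0 = 1 := by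
    rw [meromorphicOrderAt_congr hev, meromorphicOrderAt_id]
  -- assemble: `0 + 1 = 1`
  rw [hS₁, hS₂, finsum_mem_empty, finsum_mem_singleton, hord, zero_add]
  exact WithTop.untop₀_one

end Summit.SmoothPoincare4.SmoothPoincare4.Theorems.GromovRecognitionRelEnd.CrossCapLaurent
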